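import Summits.ResolutionOfSingularities.ResolutionOfSingularities.Theorems.PurelyInseparableDim4ChartChainStep
import Summits.ResolutionOfSingularities.ResolutionOfSingularities.Theorems.PurelyInseparableDim4PointStepPackage
import Summits.ResolutionOfSingularities.ResolutionOfSingularities.Theorems.PurelyInseparableDim4EquimultipleEdge
import HarnessLib

/-!
# Purely inseparable four-folds: the JOINT STEP — a COORDINATE centre blown up inside an arbitrary ambient, read by
# the POINT-regime's configuration data (brick S3 (c) «joint point∘coordinate chains», part 1, cell `res-dim4-pi`)

[OURS · counted 0] (D-0157 DOOR 2; desk WORD #66 (4)(c); frame `PIDim4.TerminationImpliesOrderReduction`, S3 (c);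
host item stmt-ResolutionOfSingularities-16155, helper). Nothing here proves resolution of singularities in
dimension ≥ 4 / characteristic `p` — NOT here, not anywhere in this programme.

The two kernel-checked regimes of S3 (c) are: the POINT regime (typ-3 lineage: configurations of finitely many closed
order-`p` points with zigzag charts, `Equimultiple.zigzag_step_package`, `…exists_isMarkedResolution_of_config_local`)
and the COORDINATE regime (typ-2 lineage: one branch of coordinate centres `V(z, x_S)` globalised from a full chart,
`ChartDictionary.coord_chain_step`). A JOINT chain blows up, at some stage of a point configuration, the GLOBAL
coordinate centre `Z_c = 𝓘(closure φ(V(z, x_S)))` of typ-2's INVARIANT(Z, φ, M, s, S) and must then hand the new stage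
back to the point regime. typ-2's `coord_chain_step` supplies the admissibility and ONE chart per `(j, b)`; what the
configuration induction needs in addition is proved here, in typ-2's dress
(`π : W → Z` ANY blowing up along `vanishingIdeal (closureImage φ (𝓘Λ S).support)`):

* §1 (model) `ordAlong_univ_step_of_isEquimultiplePoint'` (an equimultiple point of a coordinate step hands a `p`-fold
  next state), `constantCoeff_pow_add_eq_zero_of_reading` / `specMap_ξ_eq_of_reading` — for ANY blowing up `π_V` of
  `𝔸⁵_K` along `V(z, x_S)` and ANY re-centring `Θ` (`Θ z = z + h(x)`, `Θ xᵢ = xᵢ + bᵢ`) under which the controlled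
  transform reads `(z^p + (step p S j b s).F)·𝒪` on `Spec Θ ≫ chartImm_j`, the cleaning constant `h(0)` IS the `p`-th
  root `(−F′_j(b))^{1/p}`, so `(Spec Θ) ξ` is THE rational point `(a, b)` of the chart (generalises the point case
  `constantCoeff_pow_add_eq_zero_of_chart` of `…PointStepPackage` from `S = univ` to every `S`);
* §2 **`coord_step_cover`** — COVER: every CLOSED `w ∈ W` over the centre (`π w ∈ φ(V(z, x_S))`) with `ord_w M′ ≥ p`,
  `M′ = M.transform π Z_c`, is `ι (chartImm_j x)` for a chart `j ∈ S` of the restricted blow-up over `φ(𝔸⁵)` and a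
  rational `x = (a, b)` with `a^p + F′_j(b) = 0`, `b_j = 0` and `CentreBlowup.IsEquimultiplePoint p S j b s` (S3 (b)
  «POINTS» transported through typ-2's `isBlowup_restrict_globalCentre` / `comap_transform_ideal_restrict_globalCentre`);
  **`coord_step_hit`** — every re-centred chart `Spec Θ ≫ chartImm_j ≫ ι` at `b` reading the next state HITS `w`
  (`… ξ = w`), in particular typ-2's chart of `coord_chain_step`; **`coord_step_package`** — hence at every such `w`:
  an EDGE `PIDim4.Edge p S s (step p S j b s)` and a full open-immersion chart `φ″ : 𝔸⁵_K ⟶ W`, `φ″ ξ = w`,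
  `M′.ideal.comap φ″ = hypSheaf p (step p S j b s).F` (zigzag form `coord_step_package_zigzag` for the point regime);

Finite branching over the centre, survivors (closed points off `φ(V(z, x_S))` keep their orders and zigzag charts: typ-3's general-centre lemmas of
`…PointZigzag`, with `Z_c.support = φ(V(z, x_S))` by `ChartDictionary.coe_support_globalCentre`) and the assembled
joint chain theorem are part 2 (`…JointChain`). AI-produced formalisation, weaker than expert review.
bears_on: LADDER-RESOLUTION:D157-DOOR2 (res-dim4-pi · S3 (c) joint).
-/

set_option linter.dupNamespace false -- D-0017: single-problem summit path `Summit.<S>.<S>.…` by design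

noncomputable section

open MvPolynomial Finset CategoryTheory AlgebraicGeometry Opposite TopologicalSpace
open AlgebraicGeometry.Scheme.IdealSheafData (ofIdealTop vanishingIdeal)

namespace Summit.ResolutionOfSingularities.ResolutionOfSingularities.Theorems.PIDim4

open Literature.AlgebraicGeometry.Resolution
open Literature.AlgebraicGeometry.Resolution.Hauser2010
open Literature.AlgebraicGeometry.Resolution.AffinePointBlowup (P A γ coord Wtop ξ)

namespace Equimultiple

/-! ## §1 Model facts for a coordinate step (any `S`) -/

section Model

variable {K : Type} [Field K] {p : ℕ} [hp : Fact p.Prime] [CharP K p]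

omit hp [CharP K p] in
/-- **An equimultiple point of a COORDINATE step hands a `p`-fold next state**: `IsEquimultiplePoint p S j b s` ⇒
`p ≤ ord₀ (step p S j b s).F`, in the `ordAlong univ` form the point regime consumes (the case `S = univ` is
`ordAlong_univ_step_of_isEquimultiplePoint`). [cite: Hauser2010, §F (equiconstant points)] -/
theorem ordAlong_univ_step_of_isEquimultiplePoint' [DecidableEq K] (S : Finset (Fin 4)) (j : Fin 4) (b : Fin 4 → K)
    (s : State K) (heq : CentreBlowup.IsEquimultiplePoint p S j b s) :
    (p : ℕ∞) ≤ CentreBlowup.ordAlong (Finset.univ : Finset (Fin 4)) (CentreBlowup.step p S j b s).F := by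
  have h := (isEquimultiplePoint_iff_le_ordZero_step (q := p) S j b s).mp heq
  rw [natCast_le_ordZero_iff_forall_coeff] at h
  refine Finset.le_inf fun d hd => ?_
  rw [CentreBlowup.degIn_univ]
  by_contra hlt
  exact MvPolynomial.mem_support_iff.mp hd (h d (by exact_mod_cast not_le.mp hlt))

variable [DecidableEq K] {WV : Scheme.{0}} {πV : WV ⟶ P 4 K} {S : Finset (Fin 4)}

/-- **The cleaning constant is the `p`-th root (any coordinate centre, any blowing up of `𝔸⁵`).** For a blowing up
`π_V : W_V → 𝔸⁵_K` along `V(z, x_S)`, `p ≤ ord_{(x_S)} s.F`, a chart `j ∈ S`, and a re-centring `Θ` (`Θ z = z + h(x)`,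
`Θ xᵢ = xᵢ + bᵢ`) under which the controlled transform `σᶜ((z^p + s.F)·𝒪, p)` reads `(z^p + (step p S j b s).F)·𝒪` on
`Spec Θ ≫ chartImm_j`: `h(0)^p + F′_j(b) = 0` (the step polynomial has no constant term, so the model has order `≥ 1` at
the origin; read back on the chart hypersurface `V(z^p + F′_j)` at the point `(h(0), b)`).
[cite: HauserPerlega2019PRIMS, §2 (cleaning z ↦ z − F(b)^{1/p}·…)] -/
theorem constantCoeff_pow_add_eq_zero_of_reading
    (hπV : IsBlowup πV (AffineCoordBlowup.𝓘Λ 4 K (insert 0 (Fin.succ '' (S : Set (Fin 4))))))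
    (s : State K) (hperm : (p : ℕ∞) ≤ CentreBlowup.ordAlong S s.F) {j : Fin 4} (hj : j ∈ S) (b : Fin 4 → K)
    (Θ : A 4 K ≃ₐ[K] A 4 K) (h : MvPolynomial (Fin 4) K) (h0 : Θ (X 0) = X 0 + rename Fin.succ h)
    (hs : ∀ i : Fin 4, Θ (X i.succ) = X i.succ + C (b i))
    (hc : (controlledTransform πV (AffineCoordBlowup.𝓘Λ 4 K (insert 0 (Fin.succ '' (S : Set (Fin 4)))))
        (hypSheaf p s.F) p).comap (Spec.map (CommRingCat.ofHom (Θ : A 4 K →+* A 4 K)) ≫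
          AffineCoordBlowup.chartImm hπV (ChartDictionary.succ_mem_centreVars hj)) =
      hypSheaf p (CentreBlowup.step p S j b s).F) :
    constantCoeff h ^ p + MvPolynomial.eval b (CentreBlowup.chartTransform p S j s.F) = 0 := by
  haveI := isOpenImmersion_specMap_algEquiv Θ
  -- (1) the cleaned model has order `≥ 1` at the origin
  have hcons : (Fin.cons (0 : K) (0 : Fin 4 → K) : Fin (4 + 1) → K) = 0 := funext fun i => Fin.cases rfl (fun _ => rfl) i
  have hξ : (ξ 4 K).asIdeal = MvPolynomial.vanishingIdeal K {(Fin.cons 0 0 : Fin (4 + 1) → K)} := by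
    change originIdeal K (4 + 1) = _
    ext g
    rw [mem_originIdeal_iff, MvPolynomial.mem_vanishingIdeal_singleton_iff, hcons, MvPolynomial.aeval_zero]
    exact Iff.rfl
  have h1 : (1 : ℕ∞) ≤ idealOrder (hypSheaf p (CentreBlowup.step p S j b s).F) (ξ 4 K) := by
    have h := natCast_le_idealOrder_hypSheaf_iff (p := p) (CentreBlowup.step p S j b s).F hξ 1
    rw [Nat.cast_one] at h
    rw [h, hcons, PointBlowup.translate_zero, one_le_ordZero_iff, constantCoeff_hyp hp.out.ne_zero]
    show coeff 0 (deletePthPowers p (CentreBlowup.pointTransform p S j b s)) = 0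
    rw [coeff_deletePthPowers, if_pos (show IsPthPowerExponent p (0 : Fin 4 →₀ ℕ) from fun i hi => by simp at hi)]
  -- (2) read it at the rational point `(h(0), b)` of the `x_j`-chart
  have h2 : (1 : ℕ∞) ≤ ordZero (PointBlowup.translate (Fin.cons (constantCoeff h) b : Fin (4 + 1) → K)
      (hyp p (CentreBlowup.chartTransform p S j s.F))) := by
    have h3 := natCast_le_idealOrder_hypSheaf_iff (p := p) (CentreBlowup.chartTransform p S j s.F)
      (specMap_algEquiv_ξ_asIdeal Θ h b h0 hs) 1
    rw [Nat.cast_one] at h3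
    rw [← hc, Scheme.IdealSheafData.comap_comp, idealOrder_comap_of_isOpenImmersion,
      ChartDictionary.controlledTransform_comap_chartImm p hj s.F hperm hπV, h3] at h1
    exact h1
  rw [translate_hyp, one_le_ordZero_iff, map_add, map_add, map_pow, constantCoeff_X, zero_pow hp.out.ne_zero,
    zero_add, constantCoeff_C, constantCoeff_rename] at h2
  rwa [show constantCoeff (PointBlowup.translate b (CentreBlowup.chartTransform p S j s.F)) =
      MvPolynomial.eval b (CentreBlowup.chartTransform p S j s.F) from coeff_zero_translate b _] at h2

/-- **A reading re-centring hits THE rational point.** In the setting of `constantCoeff_pow_add_eq_zero_of_reading`, for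
the rational point `x = (a, b)` of the chart with `a^p + F′_j(b) = 0`: `(Spec Θ) ξ = x` — both `h(0)` and `a` are
`p`-th roots of `−F′_j(b)`, which are unique in characteristic `p`. [cite: HauserPerlega2019PRIMS, §2] -/
theorem specMap_ξ_eq_of_reading
    (hπV : IsBlowup πV (AffineCoordBlowup.𝓘Λ 4 K (insert 0 (Fin.succ '' (S : Set (Fin 4))))))
    (s : State K) (hperm : (p : ℕ∞) ≤ CentreBlowup.ordAlong S s.F) {j : Fin 4} (hj : j ∈ S) {b : Fin 4 → K}
    (Θ : A 4 K ≃ₐ[K] A 4 K) (h : MvPolynomial (Fin 4) K) (h0 : Θ (X 0) = X 0 + rename Fin.succ h)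
    (hs : ∀ i : Fin 4, Θ (X i.succ) = X i.succ + C (b i))
    (hc : (controlledTransform πV (AffineCoordBlowup.𝓘Λ 4 K (insert 0 (Fin.succ '' (S : Set (Fin 4)))))
        (hypSheaf p s.F) p).comap (Spec.map (CommRingCat.ofHom (Θ : A 4 K →+* A 4 K)) ≫
          AffineCoordBlowup.chartImm hπV (ChartDictionary.succ_mem_centreVars hj)) =
      hypSheaf p (CentreBlowup.step p S j b s).F)
    {x : P 4 K} {a : K} (hx : x.asIdeal = MvPolynomial.vanishingIdeal K {(Fin.cons a b : Fin (4 + 1) → K)})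
    (hab : a ^ p + MvPolynomial.eval b (CentreBlowup.chartTransform p S j s.F) = 0) :
    (Spec.map (CommRingCat.ofHom (Θ : A 4 K →+* A 4 K))) (ξ 4 K) = x := by
  have hroot := constantCoeff_pow_add_eq_zero_of_reading hπV s hperm hj b Θ h h0 hs hc
  have hca : constantCoeff h = a := by
    apply frobenius_inj K p
    rw [frobenius_def, frobenius_def, eq_neg_of_add_eq_zero_left hroot, eq_neg_of_add_eq_zero_left hab]
  apply PrimeSpectrum.ext
  rw [specMap_algEquiv_ξ_asIdeal Θ h b h0 hs, hca, hx]

end Model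

/-! ## §2 The coordinate step in an arbitrary ambient: cover, hit, package -/

section Cover

variable {K : Type} [Field K] {p : ℕ} [hp : Fact p.Prime] [CharP K p] [DecidableEq K]
variable {Z W : Scheme.{0}} (φ : P 4 K ⟶ Z) [IsOpenImmersion φ] {π : W ⟶ Z} {S : Finset (Fin 4)}

omit hp [CharP K p] [DecidableEq K] in
/-- Points of `W` over the chart image lie in the open `π⁻¹ φ(𝔸⁵)`. [folklore] -/
theorem mem_preimage_opensRange_of_mem_image {T : Set (P 4 K)} {w : W} (hwx : π w ∈ φ '' T) :
    w ∈ π ⁻¹ᵁ φ.opensRange := by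
  obtain ⟨y, -, hy⟩ := hwx
  exact ⟨y, hy⟩

omit hp [CharP K p] [DecidableEq K] in
/-- `π ∘ ι = ι ∘ (π |_V)` on points. [folklore] -/
theorem π_ι_eq_ι_restrict (V : Z.Opens) (z : (π ⁻¹ᵁ V : Scheme.{0})) : π ((π ⁻¹ᵁ V).ι z) = V.ι ((π ∣_ V) z) := by
  rw [← Scheme.Hom.comp_apply, ← Scheme.Hom.comp_apply, morphismRestrict_ι]

omit hp [CharP K p] [DecidableEq K] in
/-- The chart isomorphism `e = (φ.isoOpensRange)⁻¹ : φ(𝔸⁵) ≅ 𝔸⁵` followed by `φ` is the inclusion. [folklore] -/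
theorem φ_isoOpensRange_symm_hom_apply (y : (φ.opensRange : Scheme.{0})) :
    φ (φ.isoOpensRange.symm.hom y) = φ.opensRange.ι y := by
  have hι : φ.isoOpensRange.inv ≫ φ = φ.opensRange.ι := by
    rw [Iso.inv_comp_eq, Scheme.Hom.isoOpensRange_hom_ι]
  rw [← Scheme.Hom.comp_apply, Iso.symm_hom, hι]

omit hp [CharP K p] [DecidableEq K] in
/-- A point of an open subscheme is closed if it is closed in the ambient scheme. [folklore] -/
theorem isClosed_singleton_restrict (V : Z.Opens) (wt : (π ⁻¹ᵁ V : Scheme.{0}))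
    (hw : IsClosed ({(π ⁻¹ᵁ V).ι wt} : Set W)) : IsClosed ({wt} : Set (π ⁻¹ᵁ V : Scheme.{0})) := by
  have hpre : ((π ⁻¹ᵁ V).ι : (π ⁻¹ᵁ V : Scheme.{0}) → W) ⁻¹' {(π ⁻¹ᵁ V).ι wt} = {wt} := by
    ext z
    simp only [Set.mem_preimage, Set.mem_singleton_iff]
    constructor
    · intro hz
      exact (π ⁻¹ᵁ V).ι.isOpenEmbedding.injective hz
    · rintro rfl
      rfl
  rw [← hpre]
  exact hw.preimage (π ⁻¹ᵁ V).ι.continuous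

omit [DecidableEq K] in
/-- **COVER (S3 (b) «POINTS» over a GLOBAL coordinate centre).** `Z` locally Noetherian, `φ : 𝔸⁵_K ⟶ Z` an
open-immersion chart on which the marked ideal `M` of multiplicity `p` reads `(z^p + s.F)·𝒪`, `p ≤ ord_{(x_S)} s.F`,
`π : W → Z` ANY blowing up along typ-2's global centre `Z_c = 𝓘(closure φ(V(z, x_S)))`, `K = K̄`. Every CLOSED point `w`
of `W` over `φ(V(z, x_S))` at which `M′ = M.transform π Z_c` has order `≥ p` is `ι (chartImm_j x)` for some chart `j ∈ S`
of the restricted blowing up `(π |_{φ(𝔸⁵)}) ≫ e` of `𝔸⁵_K` along `V(z, x_S)` and a rational `x = (a, b)` with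
`a^p + F′_j(b) = 0`, `b_j = 0`, and `CentreBlowup.IsEquimultiplePoint p S j b s`. [cite: Hauser2010, §F (equiconstant points)]
[cite: BierstoneGrigorievMilmanWlodarczyk2011, §3.2 and Lemma 8.0.3 (2)] -/
theorem coord_step_cover [IsLocallyNoetherian Z] [IsAlgClosed K] (M : MarkedIdeal Z) (hmult : M.mult = p) (s : State K)
    (hM : M.ideal.comap φ = hypSheaf p s.F) (hperm : (p : ℕ∞) ≤ CentreBlowup.ordAlong S s.F)
    (hπ : IsBlowup π (vanishingIdeal (closureImage φ
      ((AffineCoordBlowup.𝓘Λ 4 K (insert 0 (Fin.succ '' (S : Set (Fin 4))))).support : Set (P 4 K)))))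
    {w : W} (hw : IsClosed ({w} : Set W))
    (hwx : π w ∈ φ '' (AffineCoordBlowup.CΛ 4 K (insert 0 (Fin.succ '' (S : Set (Fin 4)))) : Set (P 4 K)))
    (hord : (p : ℕ∞) ≤ idealOrder (M.transform π (vanishingIdeal (closureImage φ
      ((AffineCoordBlowup.𝓘Λ 4 K (insert 0 (Fin.succ '' (S : Set (Fin 4))))).support : Set (P 4 K))))).ideal w) :
    ∃ (j : Fin 4) (hj : j ∈ S) (x : P 4 K) (a : K) (b : Fin 4 → K),
      (π ⁻¹ᵁ φ.opensRange).ι (AffineCoordBlowup.chartImm (ChartDictionary.isBlowup_restrict_globalCentre φ _ hπ)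
          (ChartDictionary.succ_mem_centreVars hj) x) = w ∧
        x.asIdeal = MvPolynomial.vanishingIdeal K {(Fin.cons a b : Fin (4 + 1) → K)} ∧
          a ^ p + MvPolynomial.eval b (CentreBlowup.chartTransform p S j s.F) = 0 ∧ b j = 0 ∧
            CentreBlowup.IsEquimultiplePoint p S j b s := by
  haveI : IsProper π := hπ.isProper
  haveI : IsLocallyNoetherian W := LocallyOfFiniteType.isLocallyNoetherian π
  set V : Z.Opens := φ.opensRange with hV
  have hπV := ChartDictionary.isBlowup_restrict_globalCentre φ (insert 0 (Fin.succ '' (S : Set (Fin 4)))) hπ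
  set M' := M.transform π (vanishingIdeal (closureImage φ
      ((AffineCoordBlowup.𝓘Λ 4 K (insert 0 (Fin.succ '' (S : Set (Fin 4))))).support : Set (P 4 K)))) with hM'def
  set I' := controlledTransform ((π ∣_ V) ≫ φ.isoOpensRange.symm.hom)
      (AffineCoordBlowup.𝓘Λ 4 K (insert 0 (Fin.succ '' (S : Set (Fin 4))))) (hypSheaf p s.F) p with hI'
  have hres : M'.ideal.comap (π ⁻¹ᵁ V).ι = I' := by
    rw [hM'def, ChartDictionary.comap_transform_ideal_restrict_globalCentre φ _ M hπ, hmult, hM]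
  -- `w` as a point of `π⁻¹V`
  have hwV : w ∈ π ⁻¹ᵁ V := mem_preimage_opensRange_of_mem_image φ hwx
  set wt : (π ⁻¹ᵁ V : Scheme.{0}) := ⟨w, hwV⟩ with hwt
  have hιw : (π ⁻¹ᵁ V).ι wt = w := rfl
  have hwt_closed : IsClosed ({wt} : Set (π ⁻¹ᵁ V : Scheme.{0})) := isClosed_singleton_restrict V wt hw
  have hordt : (p : ℕ∞) ≤ idealOrder I' wt := by
    rw [← hres, idealOrder_comap_of_isOpenImmersion (π ⁻¹ᵁ V).ι M'.ideal wt, hιw]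
    exact hord
  -- S3 (b) «POINTS» for the restricted blowing up of `𝔸⁵`
  obtain ⟨j, hj, x, a, b, hxw, hx, hab, heq⟩ :=
    (le_idealOrder_controlledTransform_iff_exists_chart s hperm hπV hwt_closed).mp hordt
  -- over the centre: `b_j = 0`
  have hbj : b j = 0 := by
    rw [← X_succ_mem_asIdeal_iff j a b hx, ← π_chartImm_mem_CΛ_iff hπV hj x, hxw, Scheme.Hom.comp_apply]
    obtain ⟨y, hy, hyw⟩ := hwx
    have h3 : φ (φ.isoOpensRange.symm.hom ((π ∣_ V) wt)) = π w := by
      rw [φ_isoOpensRange_symm_hom_apply, ← hιw, π_ι_eq_ι_restrict]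
    have hyeq : y = φ.isoOpensRange.symm.hom ((π ∣_ V) wt) := φ.isOpenEmbedding.injective (by rw [h3, hyw])
    rw [← hyeq]
    exact hy
  exact ⟨j, hj, x, a, b, by rw [hxw]; exact hιw, hx, hab, hbj, heq⟩

/-- **HIT: every reading re-centred chart passes through the point.** In the setting of `coord_step_cover`, for the
chart `j ∈ S` and the rational point `x = (a, b)` found there (`ι (chartImm_j x) = w`, `a^p + F′_j(b) = 0`), EVERY
re-centring `Θ` at `b` (`Θ z = z + h(x)`, `Θ xᵢ = xᵢ + bᵢ`) under which `M′` reads `(z^p + (step p S j b s).F)·𝒪` on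
`φ″ = Spec Θ ≫ chartImm_j ≫ ι` — in particular the chart produced by typ-2's `ChartDictionary.coord_chain_step` /
`transform_ideal_chart_of_chart` — satisfies `φ″ ξ = w`. [cite: HauserPerlega2019PRIMS, §2 (cleaning)] -/
theorem coord_step_hit [IsLocallyNoetherian Z] (M : MarkedIdeal Z) (hmult : M.mult = p) (s : State K)
    (hM : M.ideal.comap φ = hypSheaf p s.F) (hperm : (p : ℕ∞) ≤ CentreBlowup.ordAlong S s.F)
    (hπ : IsBlowup π (vanishingIdeal (closureImage φ
      ((AffineCoordBlowup.𝓘Λ 4 K (insert 0 (Fin.succ '' (S : Set (Fin 4))))).support : Set (P 4 K)))))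
    {j : Fin 4} (hj : j ∈ S) {x : P 4 K} {a : K} {b : Fin 4 → K} {w : W}
    (hxw : (π ⁻¹ᵁ φ.opensRange).ι (AffineCoordBlowup.chartImm (ChartDictionary.isBlowup_restrict_globalCentre φ _ hπ)
      (ChartDictionary.succ_mem_centreVars hj) x) = w)
    (hx : x.asIdeal = MvPolynomial.vanishingIdeal K {(Fin.cons a b : Fin (4 + 1) → K)})
    (hab : a ^ p + MvPolynomial.eval b (CentreBlowup.chartTransform p S j s.F) = 0)
    (Θ : A 4 K ≃ₐ[K] A 4 K) (h : MvPolynomial (Fin 4) K) (h0 : Θ (X 0) = X 0 + rename Fin.succ h)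
    (hs : ∀ i : Fin 4, Θ (X i.succ) = X i.succ + C (b i))
    (hc : (M.transform π (vanishingIdeal (closureImage φ
        ((AffineCoordBlowup.𝓘Λ 4 K (insert 0 (Fin.succ '' (S : Set (Fin 4))))).support : Set (P 4 K))))).ideal.comap
        (Spec.map (CommRingCat.ofHom (Θ : A 4 K →+* A 4 K)) ≫
          AffineCoordBlowup.chartImm (ChartDictionary.isBlowup_restrict_globalCentre φ _ hπ)
            (ChartDictionary.succ_mem_centreVars hj) ≫ (π ⁻¹ᵁ φ.opensRange).ι) =
      hypSheaf p (CentreBlowup.step p S j b s).F) :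
    (Spec.map (CommRingCat.ofHom (Θ : A 4 K →+* A 4 K)) ≫
        AffineCoordBlowup.chartImm (ChartDictionary.isBlowup_restrict_globalCentre φ _ hπ)
          (ChartDictionary.succ_mem_centreVars hj) ≫ (π ⁻¹ᵁ φ.opensRange).ι) (ξ 4 K) = w := by
  haveI : IsProper π := hπ.isProper
  haveI : IsLocallyNoetherian W := LocallyOfFiniteType.isLocallyNoetherian π
  have hπV := ChartDictionary.isBlowup_restrict_globalCentre φ (insert 0 (Fin.succ '' (S : Set (Fin 4)))) hπ
  have hres : (M.transform π (vanishingIdeal (closureImage φ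
      ((AffineCoordBlowup.𝓘Λ 4 K (insert 0 (Fin.succ '' (S : Set (Fin 4))))).support : Set (P 4 K))))).ideal.comap
        (π ⁻¹ᵁ φ.opensRange).ι =
      controlledTransform ((π ∣_ φ.opensRange) ≫ φ.isoOpensRange.symm.hom)
        (AffineCoordBlowup.𝓘Λ 4 K (insert 0 (Fin.succ '' (S : Set (Fin 4))))) (hypSheaf p s.F) p := by
    rw [ChartDictionary.comap_transform_ideal_restrict_globalCentre φ _ M hπ, hmult, hM]
  have hc' : (controlledTransform ((π ∣_ φ.opensRange) ≫ φ.isoOpensRange.symm.hom)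
      (AffineCoordBlowup.𝓘Λ 4 K (insert 0 (Fin.succ '' (S : Set (Fin 4))))) (hypSheaf p s.F) p).comap
        (Spec.map (CommRingCat.ofHom (Θ : A 4 K →+* A 4 K)) ≫
          AffineCoordBlowup.chartImm hπV (ChartDictionary.succ_mem_centreVars hj)) =
      hypSheaf p (CentreBlowup.step p S j b s).F := by
    rw [Scheme.IdealSheafData.comap_comp, Scheme.IdealSheafData.comap_comp, hres] at hc
    rw [Scheme.IdealSheafData.comap_comp]
    exact hc
  have hpt := specMap_ξ_eq_of_reading hπV s hperm hj Θ h h0 hs hc' hx hab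
  rw [Scheme.Hom.comp_apply, Scheme.Hom.comp_apply, hpt]
  exact hxw

/-- **THE COORDINATE STEP PACKAGE (arbitrary ambient, typ-2's global centre).** `Z` locally Noetherian, `K = K̄` of
characteristic `p`, INVARIANT(Z, φ, M, s, S): `φ : 𝔸⁵_K ⟶ Z` an open-immersion chart with `M.ideal.comap φ = (z^p + s.F)·𝒪`,
`mult M = p`, `s.F ≠ 0` clean, `V(z, x_S)` Hironaka-permissible (`PIDim4.IsPermissibleCentre p S s.F`); `π : W → Z` ANY
blowing up along `Z_c = 𝓘(closure φ(V(z, x_S)))`. Then every CLOSED `w ∈ W` over `φ(V(z, x_S))` with `ord_w M′ ≥ p` comes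
from an EDGE `PIDim4.Edge p S s (step p S j b s)` of the coordinate-centre walk (`j ∈ S`, `b_j = 0`), and carries a full
open-immersion chart `φ″ = Spec Θ ≫ chartImm_j ≫ ι : 𝔸⁵_K ⟶ W` with `φ″ ξ = w` and
`M′.ideal.comap φ″ = hypSheaf p (step p S j b s).F` — the point regime's INVARIANT at `(W, M′, w)` with the next state
(and, by `ChartDictionary.coord_chain_step`, typ-2's INVARIANT again for every next centre `S″ ⊇ S`).
[cite: Hauser2010, §F (equiconstant points)] [cite: BierstoneGrigorievMilmanWlodarczyk2011, §3.2 and Lemma 8.0.3 (2)] -/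
theorem coord_step_package [IsLocallyNoetherian Z] [IsAlgClosed K] (M : MarkedIdeal Z) (hmult : M.mult = p)
    (s : State K) (hM : M.ideal.comap φ = hypSheaf p s.F) (hF : s.F ≠ 0)
    (hclean : Literature.Barriers.ResolutionOfSingularities.HauserPerlega.IsClean p s.F)
    (hS : IsPermissibleCentre p S s.F)
    (hπ : IsBlowup π (vanishingIdeal (closureImage φ
      ((AffineCoordBlowup.𝓘Λ 4 K (insert 0 (Fin.succ '' (S : Set (Fin 4))))).support : Set (P 4 K)))))
    {w : W} (hw : IsClosed ({w} : Set W))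
    (hwx : π w ∈ φ '' (AffineCoordBlowup.CΛ 4 K (insert 0 (Fin.succ '' (S : Set (Fin 4)))) : Set (P 4 K)))
    (hord : (p : ℕ∞) ≤ idealOrder (M.transform π (vanishingIdeal (closureImage φ
      ((AffineCoordBlowup.𝓘Λ 4 K (insert 0 (Fin.succ '' (S : Set (Fin 4))))).support : Set (P 4 K))))).ideal w) :
    ∃ (j : Fin 4) (hj : j ∈ S) (b : Fin 4 → K), b j = 0 ∧ Edge p S s (CentreBlowup.step p S j b s) ∧
      CentreBlowup.IsEquimultiplePoint p S j b s ∧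
      ∃ (Θ : A 4 K ≃ₐ[K] A 4 K) (h : MvPolynomial (Fin 4) K),
        Θ (X 0) = X 0 + rename Fin.succ h ∧ (∀ i : Fin 4, Θ (X i.succ) = X i.succ + C (b i)) ∧
        (Spec.map (CommRingCat.ofHom (Θ : A 4 K →+* A 4 K)) ≫
            AffineCoordBlowup.chartImm (ChartDictionary.isBlowup_restrict_globalCentre φ _ hπ)
              (ChartDictionary.succ_mem_centreVars hj) ≫ (π ⁻¹ᵁ φ.opensRange).ι) (ξ 4 K) = w ∧
        (M.transform π (vanishingIdeal (closureImage φ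
            ((AffineCoordBlowup.𝓘Λ 4 K (insert 0 (Fin.succ '' (S : Set (Fin 4))))).support : Set (P 4 K))))).ideal.comap
          (Spec.map (CommRingCat.ofHom (Θ : A 4 K →+* A 4 K)) ≫
            AffineCoordBlowup.chartImm (ChartDictionary.isBlowup_restrict_globalCentre φ _ hπ)
              (ChartDictionary.succ_mem_centreVars hj) ≫ (π ⁻¹ᵁ φ.opensRange).ι) =
          hypSheaf p (CentreBlowup.step p S j b s).F ∧
        ((vanishingIdeal (closureImage φ
            ((AffineCoordBlowup.𝓘Λ 4 K (insert 0 (Fin.succ '' (S : Set (Fin 4))))).support : Set (P 4 K)))).comap π).comap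
          (Spec.map (CommRingCat.ofHom (Θ : A 4 K →+* A 4 K)) ≫
            AffineCoordBlowup.chartImm (ChartDictionary.isBlowup_restrict_globalCentre φ _ hπ)
              (ChartDictionary.succ_mem_centreVars hj) ≫ (π ⁻¹ᵁ φ.opensRange).ι) =
          ofIdealTop (Ideal.span {coord 4 K j.succ}) := by
  haveI : PerfectRing K p := PerfectRing.ofSurjective K p fun x => IsAlgClosed.exists_pow_nat_eq x hp.out.pos
  obtain ⟨j, hj, x, a, b, hxw, hx, hab, hbj, heq⟩ := coord_step_cover φ M hmult s hM hS.2 hπ hw hwx hord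
  obtain ⟨Θ, h, h0, hs, hc⟩ := ChartDictionary.transform_ideal_chart_of_chart φ M hmult s hM hπ hj hbj hS.2
  have hΘj : (Θ : A 4 K →+* A 4 K) (X j.succ) = X j.succ := by
    rw [show (Θ : A 4 K →+* A 4 K) (X j.succ) = Θ (X j.succ) from rfl, hs j, hbj, C_0, add_zero]
  exact ⟨j, hj, b, hbj, edge_step_of_isEquimultiplePoint s hF hclean hS hj hbj heq, heq, Θ, h, h0, hs,
    coord_step_hit φ M hmult s hM hS.2 hπ hj hxw hx hab Θ h h0 hs hc, hc,
    ChartDictionary.comap_comap_globalCentre_chart_of_chart φ hj hΘj hπ⟩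

/-- **The coordinate step package, ZIGZAG form** (the shape the point regime's configurations carry,
`…PointTreeLocal`): at every closed order-`p` point `w` over the centre there are `j ∈ S`, `b` (`b_j = 0`), an EDGE
`Edge p S s (step p S j b s)`, and a zigzag chart `W ← Y → 𝔸⁵_K` (here `Y = 𝔸⁵_K`, `ψ = 𝟙`) at `w` on which `M′` reads
`(z^p + (step p S j b s).F)·𝒪`. [cite: BierstoneGrigorievMilmanWlodarczyk2011, §3.2] -/
theorem coord_step_package_zigzag [IsLocallyNoetherian Z] [IsAlgClosed K] (M : MarkedIdeal Z) (hmult : M.mult = p)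
    (s : State K) (hM : M.ideal.comap φ = hypSheaf p s.F) (hF : s.F ≠ 0)
    (hclean : Literature.Barriers.ResolutionOfSingularities.HauserPerlega.IsClean p s.F)
    (hS : IsPermissibleCentre p S s.F)
    (hπ : IsBlowup π (vanishingIdeal (closureImage φ
      ((AffineCoordBlowup.𝓘Λ 4 K (insert 0 (Fin.succ '' (S : Set (Fin 4))))).support : Set (P 4 K)))))
    {w : W} (hw : IsClosed ({w} : Set W))
    (hwx : π w ∈ φ '' (AffineCoordBlowup.CΛ 4 K (insert 0 (Fin.succ '' (S : Set (Fin 4)))) : Set (P 4 K)))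
    (hord : (p : ℕ∞) ≤ idealOrder (M.transform π (vanishingIdeal (closureImage φ
      ((AffineCoordBlowup.𝓘Λ 4 K (insert 0 (Fin.succ '' (S : Set (Fin 4))))).support : Set (P 4 K))))).ideal w) :
    ∃ (j : Fin 4) (b : Fin 4 → K), j ∈ S ∧ b j = 0 ∧ Edge p S s (CentreBlowup.step p S j b s) ∧
      ∃ (Y : Scheme.{0}) (φ' : Y ⟶ W) (ψ' : Y ⟶ P 4 K) (_ : IsOpenImmersion φ') (_ : IsOpenImmersion ψ') (y : Y),
        φ' y = w ∧ ψ' y = ξ 4 K ∧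
        (M.transform π (vanishingIdeal (closureImage φ
            ((AffineCoordBlowup.𝓘Λ 4 K (insert 0 (Fin.succ '' (S : Set (Fin 4))))).support : Set (P 4 K))))).ideal.comap
          φ' = (hypSheaf p (CentreBlowup.step p S j b s).F).comap ψ' := by
  haveI : IsProper π := hπ.isProper
  haveI : IsLocallyNoetherian W := LocallyOfFiniteType.isLocallyNoetherian π
  obtain ⟨j, hj, b, hbj, hedge, -, Θ, h, -, -, hξw, hc, -⟩ :=
    coord_step_package φ M hmult s hM hF hclean hS hπ hw hwx hord
  haveI := isOpenImmersion_specMap_algEquiv Θ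
  exact ⟨j, b, hj, hbj, hedge, P 4 K, _, 𝟙 _, inferInstance, inferInstance, ξ 4 K, hξw, rfl,
    by rw [Scheme.IdealSheafData.comap_id]; exact hc⟩

end Cover


end Equimultiple

end Summit.ResolutionOfSingularities.ResolutionOfSingularities.Theorems.PIDim4

end
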